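import Mathlib
import Summits.Ventures.PercRepro2.TypedSpectator

/-!
# The four typed covariances of the crux kernel (blind cell PercRepro2, mine-2 g44, 2026-08-29;
`conjectures/MINE-2.md` M2-89, `proofs/MINE2-PIECES.md`)

The eight terms of `K₃` (`HCovCubic.lean`) pair into four term-pair kernels — the objects the
seven-vertex census of M2-89 computes cell by cell:

* `KA = t₁ + t₄ = 1_PD(x)·[1_Q(y)·f₄(w) − f₇ᵇ(y)·f₇ᵒ(w)]` (the typed side-agreement piece),
* `KP2 = t₂ + t₅ = 1_Q(x)·f₃(y)·f₅(w) − f₃(x)·f₇ᵇ(y)·f₇³(w)`,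
* `KU = t₃ + t₆ = −1_PD(x)·[1_Q(y)·f₆(w) − f₇ᵇ(y)·f₁₀(w)]`,
* `KC = t₇ + t₈ = −1_PD(x)·1_Q(y)·f₁₁(w) + 1_Q(x)·f₁₂(y)·f₃(w)`,

`K₃ = KA + KP2 + KU + KC` pointwise (`K3_eq_pieces`), so every typed count splits accordingly
(`typedCount_K3_eq_pieces`). Symmetrised over the last two copies they are night-3's covariance
kernels: `2·typedCount KA = typedCount (1_PD(x)·covKer(σ_b, σ_o))`, and the three covariance
pieces add up to night-3's `covPart` while `KC` is `−pdPart/2` (`two_mul_typedCount_cov_eq_covPart`,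
`two_mul_typedCount_KC_eq_neg_pdPart`).

**`typedCount_KA_nonneg`** / **`typedCount_KP2_nonneg`**: the typed side-agreement pieces are
nonnegative on every instance under the two-copy cross and same-side statements `CrossCount` /
`SameCount` (row 2′TBHK / 2′TB) for the pair `(b, o)`, resp. `(b, a₃)` — the spectator copy carries
the nonnegative weight `1_PD`, resp. `1_PD·1_{o∈U}`, and the remaining pair is a two-copy covariance
count (`pinnedCount_covKer_nonneg`). This is the copy factorisation behind the census reading of
M2-89 (A ≥ 0 and P2 ≥ 0 on all 1,428,670,872 cells of the seven-vertex class are consequences of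
2′TB, not new rows).

**`TypedNoC`** / **`TypedNoU`**: the two census-clean statements of M2-89 as Props — the typed count
of `KA + KP2 + KU` (= N − C, the typed `D·P(Q)²·Cov_μ(σ_b, F)`, night-3's `T_cov/2`) and of
`KA + KP2 + KC` (= N − U) are nonnegative; 0 negative cells on the whole seven-vertex class, all
three markings (kit j328221); candidates, NOT theorems, nothing here proves them.
Own code; standard axioms.
-/

namespace Summit.Ventures.PercRepro2

open UnionCluster

namespace CovForm

namespace TypedPieces

open TypedA3

section Kernels

variable {V : Type*} {E : Type*} {R : Type*} [Field R]

/-- `KA = t₁ + t₄`: the typed side-agreement piece `1_PD(x)·[1_Q(y)·f₄(w) − f₇ᵇ(y)·f₇ᵒ(w)]`. -/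
noncomputable def KA (ends : E → Sym2 V) (o a₁ a₂ a₃ b : V) (x y w : Config E) : R :=
  iPD ends a₁ a₂ a₃ x * (iQ ends a₁ a₂ y * f4 ends o a₁ a₂ b w - f7 ends a₁ a₂ b y * f7 ends a₁ a₂ o w)

/-- `KP2 = t₂ + t₅ = 1_Q(x)·f₃(y)·f₅(w) − f₃(x)·f₇ᵇ(y)·f₇³(w)`. -/
noncomputable def KP2 (ends : E → Sym2 V) (o a₁ a₂ a₃ b : V) (x y w : Config E) : R :=
  iQ ends a₁ a₂ x * (f3 ends o a₁ a₂ a₃ y * f5 ends a₁ a₂ a₃ b w) -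
    f3 ends o a₁ a₂ a₃ x * (f7 ends a₁ a₂ b y * f7 ends a₁ a₂ a₃ w)

/-- `KU = t₃ + t₆ = −1_PD(x)·[1_Q(y)·f₆(w) − f₇ᵇ(y)·f₁₀(w)]`. -/
noncomputable def KU (ends : E → Sym2 V) (o a₁ a₂ a₃ b : V) (x y w : Config E) : R :=
  -(iPD ends a₁ a₂ a₃ x *
    (iQ ends a₁ a₂ y * f6 ends o a₁ a₂ a₃ b w - f7 ends a₁ a₂ b y * f10 ends o a₁ a₂ a₃ w))

/-- `KC = t₇ + t₈ = −1_PD(x)·1_Q(y)·f₁₁(w) + 1_Q(x)·f₁₂(y)·f₃(w)`. -/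
noncomputable def KC (ends : E → Sym2 V) (o a₁ a₂ a₃ b : V) (x y w : Config E) : R :=
  -(iPD ends a₁ a₂ a₃ x * (iQ ends a₁ a₂ y * f11 ends o a₁ a₂ a₃ b w)) +
    iQ ends a₁ a₂ x * (f12 ends a₁ a₂ a₃ b y * f3 ends o a₁ a₂ a₃ w)

/-- **The kernel is the sum of its four covariance pieces** (a polynomial identity in the twelve
functions). -/
theorem K3_eq_pieces (ends : E → Sym2 V) (o a₁ a₂ a₃ b : V) (x y w : Config E) :
    (K3 ends o a₁ a₂ a₃ b x y w : R) =
      KA ends o a₁ a₂ a₃ b x y w + KP2 ends o a₁ a₂ a₃ b x y w + KU ends o a₁ a₂ a₃ b x y w +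
        KC ends o a₁ a₂ a₃ b x y w := by
  unfold K3 sepKernel
  simp only [Fin.sum_univ_succ, Fin.sum_univ_zero, Matrix.cons_val_zero, Matrix.cons_val_succ,
    add_zero]
  unfold KA KP2 KU KC
  ring

end Kernels

section Counts

variable {V : Type*} {E : Type*} [Fintype E] [DecidableEq E] {R : Type*} [Field R]

/-- **Every typed count of `K₃` is the sum of the four covariance counts.** -/
theorem typedCount_K3_eq_pieces (ends : E → Sym2 V) (o a₁ a₂ a₃ b : V) (F : Finset E)
    (z : Config E) (τ : E → ℕ) :
    typedCount F z τ (K3 ends o a₁ a₂ a₃ b : Config E → Config E → Config E → R) =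
      typedCount F z τ (KA (R := R) ends o a₁ a₂ a₃ b) +
        typedCount F z τ (KP2 (R := R) ends o a₁ a₂ a₃ b) +
        typedCount F z τ (KU (R := R) ends o a₁ a₂ a₃ b) +
        typedCount F z τ (KC (R := R) ends o a₁ a₂ a₃ b) := by
  rw [← typedCount_add', ← typedCount_add', ← typedCount_add']
  exact typedCount_congr' F z τ _ _ fun x y w => K3_eq_pieces ends o a₁ a₂ a₃ b x y w

/-- Symmetrised over the last two copies, `KA` is the `PD`-weighted two-copy covariance of the
side signs of `b` and `o`. -/
theorem two_mul_typedCount_KA (ends : E → Sym2 V) (o a₁ a₂ a₃ b : V) (F : Finset E)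
    (z : Config E) (τ : E → ℕ) (hτ : ∀ e ∈ F, τ e = 1 ∨ τ e = 2) :
    2 * typedCount F z τ (KA (R := R) ends o a₁ a₂ a₃ b) =
      typedCount F z τ (fun x y w => iPD (R := R) ends a₁ a₂ a₃ x *
        covKer ends a₁ a₂ (sigma ends a₁ a₂ b) (sigma ends a₁ a₂ o) y w) := by
  have hs := typedCount_swap23 F z τ hτ (KA (R := R) ends o a₁ a₂ a₃ b)
  rw [two_mul]
  nth_rewrite 2 [← hs]
  rw [← typedCount_add']
  refine typedCount_congr' F z τ _ _ fun x y w => ?_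
  unfold KA covKer f4 f7
  ring

/-- Symmetrised over the last two copies (after moving the spectator `f₃` to the first copy),
`KP2` is the `[PD·1_{o∈U}]`-weighted two-copy covariance of the side signs of `b` and `a₃`. -/
theorem two_mul_typedCount_KP2 (ends : E → Sym2 V) (o a₁ a₂ a₃ b : V) (F : Finset E)
    (z : Config E) (τ : E → ℕ) (hτ : ∀ e ∈ F, τ e = 1 ∨ τ e = 2) :
    2 * typedCount F z τ (KP2 (R := R) ends o a₁ a₂ a₃ b) =
      typedCount F z τ (fun x y w => f3 (R := R) ends o a₁ a₂ a₃ x *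
        covKer ends a₁ a₂ (sigma ends a₁ a₂ b) (sigma ends a₁ a₂ a₃) y w) := by
  -- the first term of `KP2` with the spectator moved to the first copy
  have e1 : typedCount F z τ (KP2 (R := R) ends o a₁ a₂ a₃ b) =
      typedCount F z τ (fun x y w => f3 (R := R) ends o a₁ a₂ a₃ x *
        (iQ ends a₁ a₂ y * f5 ends a₁ a₂ a₃ b w - f7 ends a₁ a₂ b y * f7 ends a₁ a₂ a₃ w)) := by
    have h1 : typedCount F z τ (fun x y w => iQ (R := R) ends a₁ a₂ x *
          (f3 ends o a₁ a₂ a₃ y * f5 ends a₁ a₂ a₃ b w)) =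
        typedCount F z τ (fun x y w => f3 (R := R) ends o a₁ a₂ a₃ x *
          (iQ ends a₁ a₂ y * f5 ends a₁ a₂ a₃ b w)) := by
      rw [← typedCount_swap12 F z τ (fun x y w => f3 (R := R) ends o a₁ a₂ a₃ x *
        (iQ ends a₁ a₂ y * f5 ends a₁ a₂ a₃ b w))]
      exact typedCount_congr' F z τ _ _ fun x y w => by ring
    have h2 : typedCount F z τ (KP2 (R := R) ends o a₁ a₂ a₃ b) =
        typedCount F z τ (fun x y w => iQ (R := R) ends a₁ a₂ x *
          (f3 ends o a₁ a₂ a₃ y * f5 ends a₁ a₂ a₃ b w)) +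
        typedCount F z τ (fun x y w => -(f3 (R := R) ends o a₁ a₂ a₃ x *
          (f7 ends a₁ a₂ b y * f7 ends a₁ a₂ a₃ w))) := by
      rw [← typedCount_add']
      exact typedCount_congr' F z τ _ _ fun x y w => by unfold KP2; ring
    rw [h2, h1, ← typedCount_add']
    exact typedCount_congr' F z τ _ _ fun x y w => by ring
  rw [e1]
  set K : Config E → Config E → Config E → R := fun x y w => f3 (R := R) ends o a₁ a₂ a₃ x *
    (iQ ends a₁ a₂ y * f5 ends a₁ a₂ a₃ b w - f7 ends a₁ a₂ b y * f7 ends a₁ a₂ a₃ w) with hK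
  have hs := typedCount_swap23 F z τ hτ K
  rw [two_mul]
  nth_rewrite 2 [← hs]
  rw [← typedCount_add']
  refine typedCount_congr' F z τ _ _ fun x y w => ?_
  simp only [hK]
  unfold covKer f5 f7
  ring

/-- The three covariance pieces add up to night-3's `covPart` (twice the typed count). -/
theorem two_mul_typedCount_cov_eq_covPart (ends : E → Sym2 V) (o a₁ a₂ a₃ b : V) (F : Finset E)
    (z : Config E) (τ : E → ℕ) (hτ : ∀ e ∈ F, τ e = 1 ∨ τ e = 2) :
    2 * (typedCount F z τ (KA (R := R) ends o a₁ a₂ a₃ b) +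
      typedCount F z τ (KP2 (R := R) ends o a₁ a₂ a₃ b) +
      typedCount F z τ (KU (R := R) ends o a₁ a₂ a₃ b)) =
      typedCount F z τ (covPart (R := R) ends o a₁ a₂ a₃ b) := by
  have hA := two_mul_typedCount_KA (R := R) ends o a₁ a₂ a₃ b F z τ hτ
  have hP := two_mul_typedCount_KP2 (R := R) ends o a₁ a₂ a₃ b F z τ hτ
  have hU : 2 * typedCount F z τ (KU (R := R) ends o a₁ a₂ a₃ b) =
      typedCount F z τ (fun x y w => -(iPD (R := R) ends a₁ a₂ a₃ x *
        covKer ends a₁ a₂ (sigma ends a₁ a₂ b)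
          (fun ω => sigma ends a₁ a₂ a₃ ω * inU ends a₁ a₂ o ω) y w)) := by
    have hs := typedCount_swap23 F z τ hτ (KU (R := R) ends o a₁ a₂ a₃ b)
    rw [two_mul]
    nth_rewrite 2 [← hs]
    rw [← typedCount_add']
    refine typedCount_congr' F z τ _ _ fun x y w => ?_
    unfold KU covKer f6 f7 f10
    ring
  rw [mul_add, mul_add, hA, hP, hU, ← typedCount_add', ← typedCount_add']
  refine typedCount_congr' F z τ _ _ fun x y w => ?_
  unfold covPart
  ring

/-- `KC` is `−pdPart/2` (twice the typed count of `KC` is minus night-3's `T_pd`). -/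
theorem two_mul_typedCount_KC_eq_neg_pdPart (ends : E → Sym2 V) (o a₁ a₂ a₃ b : V)
    (F : Finset E) (z : Config E) (τ : E → ℕ) (hτ : ∀ e ∈ F, τ e = 1 ∨ τ e = 2) :
    2 * typedCount F z τ (KC (R := R) ends o a₁ a₂ a₃ b) =
      -typedCount F z τ (pdPart (R := R) ends o a₁ a₂ a₃ b) := by
  have hs := typedCount_swap23 F z τ hτ (KC (R := R) ends o a₁ a₂ a₃ b)
  rw [two_mul, ← typedCount_neg']
  nth_rewrite 2 [← hs]
  rw [← typedCount_add']
  refine typedCount_congr' F z τ _ _ fun x y w => ?_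
  unfold KC pdPart P4 P2
  ring

end Counts

section Nonneg

variable {V : Type*} {E : Type*} [Fintype E] [DecidableEq E] {R : Type*} [Field R]
  [LinearOrder R] [IsStrictOrderedRing R]

omit [Fintype E] [DecidableEq E] in
/-- `1_PD ≥ 0`. -/
lemma iPD_nonneg' (ends : E → Sym2 V) (a₁ a₂ a₃ : V) (x : Config E) :
    (0 : R) ≤ iPD ends a₁ a₂ a₃ x := by
  unfold iPD
  exact Set.indicator_nonneg (fun _ _ => zero_le_one) x

omit [Fintype E] [DecidableEq E] in
/-- `f₃ = 1_PD·1_{o∈U} ≥ 0`. -/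
lemma f3_nonneg' (ends : E → Sym2 V) (o a₁ a₂ a₃ : V) (x : Config E) :
    (0 : R) ≤ f3 ends o a₁ a₂ a₃ x := by
  unfold f3 inU iL iH
  refine mul_nonneg (iPD_nonneg' ends a₁ a₂ a₃ x) (add_nonneg ?_ ?_) <;>
    exact Set.indicator_nonneg (fun _ _ => zero_le_one) x

/-- **The spectator lift**: a typed count of `f(x)·K(y, w)` with `f ≥ 0` and every two-copy count
of `K` nonnegative is nonnegative. -/
theorem typedCount_spectator_nonneg (F : Finset E) (z : Config E) (τ : E → ℕ)
    (hτ : ∀ e ∈ F, τ e = 1 ∨ τ e = 2) (f : Config E → R) (hf : ∀ x, 0 ≤ f x)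
    (K : Config E → Config E → R) (hK : ∀ (G : Finset E) (z' : Config E), 0 ≤ pinnedCount G z' K) :
    0 ≤ typedCount F z τ (fun x y w => f x * K y w) := by
  rw [typedCount_eq_sum_spec F z τ hτ]
  refine Finset.sum_nonneg fun x _ => ?_
  split_ifs
  · rw [pinnedCount_const_mul]
    exact mul_nonneg (hf x) (hK _ _)
  · exact le_rfl

/-- **The typed side-agreement piece is nonnegative under the two-copy cross and same-side
statements for `(b, o)`** (row 2′TBHK / 2′TB): `A = typedCount KA ≥ 0` on every instance. -/
theorem typedCount_KA_nonneg (ends : E → Sym2 V) (o a₁ a₂ a₃ b : V)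
    (hc₁ : CrossCount R ends a₁ a₂ o b) (hc₂ : CrossCount R ends a₁ a₂ b o)
    (hs₁ : SameCount (R := R) ends a₁ a₂ b o) (hs₂ : SameCount (R := R) ends a₂ a₁ b o)
    (F : Finset E) (z : Config E) (τ : E → ℕ) (hτ : ∀ e ∈ F, τ e = 1 ∨ τ e = 2) :
    0 ≤ typedCount F z τ (KA (R := R) ends o a₁ a₂ a₃ b) := by
  have h := two_mul_typedCount_KA (R := R) ends o a₁ a₂ a₃ b F z τ hτ
  have hnn : 0 ≤ typedCount F z τ (fun x y w => iPD (R := R) ends a₁ a₂ a₃ x *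
      covKer ends a₁ a₂ (sigma ends a₁ a₂ b) (sigma ends a₁ a₂ o) y w) :=
    typedCount_spectator_nonneg F z τ hτ _ (iPD_nonneg' ends a₁ a₂ a₃) _
      (pinnedCount_covKer_nonneg ends a₁ a₂ b o hc₁ hc₂ hs₁ hs₂)
  rw [← h] at hnn
  linarith

/-- **The typed `(b, a₃)` side-agreement piece is nonnegative under the two-copy cross and
same-side statements for `(b, a₃)`**: `P2 = typedCount KP2 ≥ 0` on every instance. -/
theorem typedCount_KP2_nonneg (ends : E → Sym2 V) (o a₁ a₂ a₃ b : V)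
    (hc₁ : CrossCount R ends a₁ a₂ a₃ b) (hc₂ : CrossCount R ends a₁ a₂ b a₃)
    (hs₁ : SameCount (R := R) ends a₁ a₂ b a₃) (hs₂ : SameCount (R := R) ends a₂ a₁ b a₃)
    (F : Finset E) (z : Config E) (τ : E → ℕ) (hτ : ∀ e ∈ F, τ e = 1 ∨ τ e = 2) :
    0 ≤ typedCount F z τ (KP2 (R := R) ends o a₁ a₂ a₃ b) := by
  have h := two_mul_typedCount_KP2 (R := R) ends o a₁ a₂ a₃ b F z τ hτ
  have hnn : 0 ≤ typedCount F z τ (fun x y w => f3 (R := R) ends o a₁ a₂ a₃ x *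
      covKer ends a₁ a₂ (sigma ends a₁ a₂ b) (sigma ends a₁ a₂ a₃) y w) :=
    typedCount_spectator_nonneg F z τ hτ _ (f3_nonneg' ends o a₁ a₂ a₃) _
      (pinnedCount_covKer_nonneg ends a₁ a₂ b a₃ hc₁ hc₂ hs₁ hs₂)
  rw [← h] at hnn
  linarith

end Nonneg

section Rows

variable {V : Type*} {E : Type*} [Fintype E] [DecidableEq E] {R : Type*} [Field R]
  [LinearOrder R] [IsStrictOrderedRing R]

/-- **Candidate (TRI − C)**: the typed count of `KA + KP2 + KU` — the crux kernel without its
`PD`-covariance terms, the typed `D·P(Q)²·Cov_μ(σ_b, F)` (= `covPart/2`) — is nonnegative on every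
instance. Census (M2-89, kit j328221): 0 negative cells on the seven-vertex class, all three
markings (1,428,670,872 + 2 × 1,562,976 cells). A candidate, NOT a theorem. -/
def TypedNoC (ends : E → Sym2 V) (o a₁ a₂ a₃ b : V) : Prop :=
  ∀ (F : Finset E) (z : Config E) (τ : E → ℕ), (∀ e ∈ F, τ e = 1 ∨ τ e = 2) →
    0 ≤ typedCount F z τ (fun x y w => KA (R := R) ends o a₁ a₂ a₃ b x y w +
      KP2 ends o a₁ a₂ a₃ b x y w + KU ends o a₁ a₂ a₃ b x y w)

/-- **Candidate (TRI − U)**: the typed count of `KA + KP2 + KC` — the crux kernel without its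
`σ₃·1_{o∈U}` covariance terms — is nonnegative on every instance. Census (M2-89): 0 negative cells
on the seven-vertex class, all three markings. A candidate, NOT a theorem. -/
def TypedNoU (ends : E → Sym2 V) (o a₁ a₂ a₃ b : V) : Prop :=
  ∀ (F : Finset E) (z : Config E) (τ : E → ℕ), (∀ e ∈ F, τ e = 1 ∨ τ e = 2) →
    0 ≤ typedCount F z τ (fun x y w => KA (R := R) ends o a₁ a₂ a₃ b x y w +
      KP2 ends o a₁ a₂ a₃ b x y w + KC ends o a₁ a₂ a₃ b x y w)

omit [LinearOrder R] [IsStrictOrderedRing R] in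
/-- The typed count of `K₃` is the count of `KA + KP2 + KU` plus the count of `KC`. -/
theorem typedCount_K3_eq_noC_add_KC (ends : E → Sym2 V) (o a₁ a₂ a₃ b : V) (F : Finset E)
    (z : Config E) (τ : E → ℕ) :
    typedCount F z τ (K3 ends o a₁ a₂ a₃ b : Config E → Config E → Config E → R) =
      typedCount F z τ (fun x y w => KA (R := R) ends o a₁ a₂ a₃ b x y w +
        KP2 ends o a₁ a₂ a₃ b x y w + KU ends o a₁ a₂ a₃ b x y w) +
      typedCount F z τ (KC (R := R) ends o a₁ a₂ a₃ b) := by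
  rw [← typedCount_add']
  exact typedCount_congr' F z τ _ _ fun x y w => K3_eq_pieces ends o a₁ a₂ a₃ b x y w

omit [LinearOrder R] [IsStrictOrderedRing R] in
/-- The typed count of `K₃` is the count of `KA + KP2 + KC` plus the count of `KU`. -/
theorem typedCount_K3_eq_noU_add_KU (ends : E → Sym2 V) (o a₁ a₂ a₃ b : V) (F : Finset E)
    (z : Config E) (τ : E → ℕ) :
    typedCount F z τ (K3 ends o a₁ a₂ a₃ b : Config E → Config E → Config E → R) =
      typedCount F z τ (fun x y w => KA (R := R) ends o a₁ a₂ a₃ b x y w +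
        KP2 ends o a₁ a₂ a₃ b x y w + KC ends o a₁ a₂ a₃ b x y w) +
      typedCount F z τ (KU (R := R) ends o a₁ a₂ a₃ b) := by
  rw [← typedCount_add']
  exact typedCount_congr' F z τ _ _ fun x y w => by
    rw [K3_eq_pieces ends o a₁ a₂ a₃ b x y w]; ring

/-- **Row 2′TRI from (TRI − C) wherever the `PD`-covariance count is nonnegative**, and from
(TRI − U) wherever the `U`-count is nonnegative: the two candidates cover the row on complementary
halves of the class. -/
theorem typedCount_K3_nonneg_of_noC (ends : E → Sym2 V) (o a₁ a₂ a₃ b : V)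
    (h : TypedNoC (R := R) ends o a₁ a₂ a₃ b) (F : Finset E) (z : Config E) (τ : E → ℕ)
    (hτ : ∀ e ∈ F, τ e = 1 ∨ τ e = 2) (hC : 0 ≤ typedCount F z τ (KC (R := R) ends o a₁ a₂ a₃ b)) :
    0 ≤ typedCount F z τ (K3 ends o a₁ a₂ a₃ b : Config E → Config E → Config E → R) := by
  rw [typedCount_K3_eq_noC_add_KC]
  exact add_nonneg (h F z τ hτ) hC

end Rows

end TypedPieces

end CovForm

end Summit.Ventures.PercRepro2
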